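import Literature.MathematicalPhysics.QuantumFieldTheory.Balaban1983to89.Beta.VectorPropagatorLimit
import Summits.QuantumFields.BalabanUV.Beta.TameKernelCalculus

/-!
# `BalabanUV.Beta.D1BFx.GluonLeg` — road «BF-x» for binder row D1, typer object T1: THE REDUCED BF GLUON LEG `Ga n a` IS THE
# INFINITE-VOLUME VECTOR PROPAGATOR `K^∞` READ AS A MATRIX-FIBRED KERNEL — re-indexing, symmetry, block covariance, temperedness,
# and the dictionary to the wall's displacement function `GfE`

HONEST FRAMING (cell contract, verbatim): «discharging `BetaPertH` makes Bałaban's UV stability UNCONDITIONAL — a real constructive-QFT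
result; it is NOT the continuum limit and NOT the Clay problem.»  HONEST DEPENDENCY (verbatim): «continuum YM on T⁴ ⇐ BetaPertH ∧ nine
spine estimates (0/9 proved); BetaPertH ⇐ (D1) ∧ (D4) ∧ CAP+tail; G-an2-4 gates asym, D1 and NE2/3/4.»  THIS MODULE DISCHARGES NOTHING.
It is ONE DEFINITION-BY-RE-INDEXING over an object already in the tree (an5's `VectorPropagatorLimit.Kinf`, the entrywise `T ↗ ℤ⁴`
limit of `n²·Δ_a⁻¹` at `U = 1`) and the transfer of that module's structure theorems to the `ExpKernelCalculus.MKer` currency in which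
the road's kernels (`bubble`, `tadpole`, `hessKer`) are written.  No `Prop` is minted, nothing is cited as a hypothesis, 0 sorry.
NOT summit progress; NOT BetaPertH, NOT continuum, NOT Clay.

ABSOLUTE RULE (cell, verbatim): «No internally-minted statement may enter as a cited fact. Every hypothesis is either kernel-proved in this
package or a verbatim quotation of a PUBLISHED theorem with page reference. The manuscript(s) under audit are NOT citable for their own
disputed steps — they are the thing under adjudication; programme-internal (2001/route/tribunal) claims are never citable.»

WHY (skeleton `HOME/beta/skeletons/D1-b2b-balaban-beta-d1-p2.md` v1.4 node O/R, typer spec `HOME/b2b-balaban-beta-d1-p2/TYPER-SPEC-D1BFx.md`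
§1 T1, claim table `LEAVES-BFx.md` row T1).  In the REDUCED background-Feynman representation of the first step at block `n` (K-R2) the
gluon legs of every one-loop term are entries of `Ga := Δ_a⁻¹` (B5 (1.69)–(1.73)/(1.83) at `U = 1`; CONTEXT ONLY — nothing printed is
asserted), which this lineage holds on `ℤ⁴` as `Kinf n a : (ℤ⁴ × {0..3}) → (ℤ⁴ × {0..3}) → ℝ`.  The road's kernels `Pgl/Pgh` (T7), the
block-inverse dictionary (K-R2) and the A-leaves all speak `MKer 4 (Fin 4) = Site 4 → Site 4 → Fin 4 → Fin 4 → ℝ`; this file is the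
adapter, so that every later leaf imports ONE name with its structure lemmas attached.

CONTENT (all [folklore] / [our object]).
* §1 `Ga n a : MKer 4 (Fin 4) := fun x y κ l => Kinf n a (x, κ) (y, l)` (TYPER-SPEC T1 verbatim), `Ga_apply`; the component formulas
  `Ga_diag` (`δ`-line: `G₀(y − x) − n²·Re R⊥ + n²·Re 𝓛`) and `Ga_of_ne` (off the component diagonal: pure longitudinal line, `Kinf_of_ne`);
  `Ga_eq_KinfBlock` (an4's `Kernel₂` vocabulary) and `isPeriodic₂_Ga`.
* §2 STRUCTURE: `Ga_symm` / `trK_Ga` (symmetric kernel, `Kinf_symm`), `shiftK_Ga` / `shiftK_Ga_neg` (block-translation covariance with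
  period `n`, `Kinf_blockShift` — the `covA` field of `ExpKernelCalculus.BlockCovariant`), `blockCovariant_Ga` (hence `hess_Ga_eq_hessKer`:
  the base point `0` represents every base point for ANY block-covariant vertex families over `Ga`), `abs_Ga_le` / `bdd_Ga`
  (temperedness `|Ga| ≤ n²/γ₀(4,a)`, `abs_Kinf_le`).
* §3 THE READING: `Ga_eq_GfE` — the diagonal displacement function of `Ga` at base point `p`, component `κ`, IS the wall's explicit
  limit family `VectorLegVolumeAdapter.GfE a k n (p, ℓ)` (`GfE_eq_Kinf`), so the (R17) window/tail rows of that module and an3's scalar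
  END speak about `Ga`'s diagonal entries BY NAME; `Ga_eq_baseFun`; and `tendsto_Ga` — `Ga` IS the `T ↗ ℤ⁴` limit of `n²·Re Δ_a⁻¹`
  along the even cubic volumes (node V's passage for the legs, `calG_re_tendsto_Kinf`).
WHAT IS NOT HERE (honest): NO decay statement `ExpKernelCalculus.Decays (Ga n a) C (δ/n)`.  It is not derivable from the tree today
(`Kinf = δ·(G₀ − n²Re R⊥) + n²Re 𝓛` with the massless free leg `G₀ ~ |x−y|⁻²` split off; the scale-`n` exponential decay of the SUM is
the content of B5 Prop. 1.2, an (α)-leaf), so the road's T7/A-leaves that need summability take `(hGa : Decays (Ga n a) C δ)` as an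
explicit binder — nothing is minted here to hide that.
-/

noncomputable section

open Filter Topology

namespace Summit.QuantumFields.BalabanUV.Beta.D1BFx.GluonLeg

open Literature.MathematicalPhysics.QuantumFieldTheory.Balaban1983to89
open Literature.MathematicalPhysics.QuantumFieldTheory.Balaban1983to89.Beta
open Literature.MathematicalPhysics.QuantumFieldTheory.Balaban1983to89.B5Prop11Plancherel
open Literature.MathematicalPhysics.QuantumFieldTheory.Balaban1983to89.B5Prop11Lattice (gammaZero gammaZero_pos)
open ExpKernelCalculus (Site MKer shiftK BlockCovariant hess hessKer hess_eq_hessKer)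
open KernelWard (Bdd)
open Summit.QuantumFields.BalabanUV.Beta.TameKernelCalculus (trK)
open Literature.MathematicalPhysics.QuantumFieldTheory.Balaban1983to89.Beta.DyadicShell (Pt)
open Literature.MathematicalPhysics.QuantumFieldTheory.Balaban1983to89.Beta.PoissonInterior (G₀)
open Literature.MathematicalPhysics.QuantumFieldTheory.Balaban1983to89.Beta.LongitudinalSymbol (LkerLim)
open Literature.MathematicalPhysics.QuantumFieldTheory.Balaban1983to89.Beta.WoodburyBondSymbol (RperpBLim)
open Literature.MathematicalPhysics.QuantumFieldTheory.Balaban1983to89.Beta.BlockKernelVolumeSockets (evenPeriod)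
open Literature.MathematicalPhysics.QuantumFieldTheory.Balaban1983to89.Beta.VectorLegVolumeAdapter (GfE)
open Literature.MathematicalPhysics.QuantumFieldTheory.Balaban1983to89.Beta.FreeLegDictionary (cubic)
open Literature.MathematicalPhysics.QuantumFieldTheory.Balaban1983to89.Beta.VectorTails (castT)
open Literature.MathematicalPhysics.QuantumFieldTheory.Balaban1983to89.Beta.VectorPropagatorLimit

/-! ## §1 The object and its entry formulas -/

/-- [our object] **T1 — THE REDUCED BF GLUON LEG**: the infinite-volume vector propagator `K^∞` of this lineage (entrywise `T ↗ ℤ⁴`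
limit of `n²·Δ_a⁻¹` at `U = 1`, block `n`, averaging weight `a`), re-indexed as a matrix-fibred kernel on `ℤ⁴` with fibre `Fin 4`
(the bond direction): `Ga n a x y κ l = K^∞((x,κ),(y,l))`.  A DEFINITION; asserts nothing. -/
def Ga (n : ℕ) [NeZero n] (a : ℝ) : MKer 4 (Fin 4) := fun x y κ l => Kinf n a (x, κ) (y, l)

variable (n : ℕ) [NeZero n] (a : ℝ)

/-- [our object] Unfolding. -/
@[simp] theorem Ga_apply (x y : Site 4) (κ l : Fin 4) : Ga n a x y κ l = Kinf n a (x, κ) (y, l) := rfl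

/-- [folklore] THE DIAGONAL COMPONENT FORMULA: `Ga((x,κ),(y,κ)) = G₀(y − x) − n²·Re R⊥_{w_κ,∞}(X,X′) + n²·Re 𝓛_∞((X,κ),(X′,κ))` with the
canonical representatives `X = repO n x y`, `X′ = repS n x y` (free `ℤ⁴` leg + bond-block Woodbury line + longitudinal line). -/
theorem Ga_diag (x y : Site 4) (κ : Fin 4) :
    Ga n a x y κ κ = G₀ (y - x) - ((n : ℕ) : ℝ) ^ 2 * (RperpBLim n a 0 κ (repO n x y) (repS n x y)).re
      + ((n : ℕ) : ℝ) ^ 2 * (LkerLim n a (repO n x y) κ (repS n x y) κ).re := by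
  simp [Ga, Kinf]

omit [NeZero n] in
/-- [folklore] OFF THE COMPONENT DIAGONAL `Ga` IS PURE LONGITUDINAL LINE: `Ga((x,κ),(y,l)) = n²·Re 𝓛_∞((X,κ),(X′,l))`, `κ ≠ l`
(`Kinf_of_ne`; these are the entries bounded by `LongitudinalWindow`, the L1′ remainder of the road). -/
theorem Ga_of_ne [NeZero n] {κ l : Fin 4} (h : κ ≠ l) (x y : Site 4) :
    Ga n a x y κ l = ((n : ℕ) : ℝ) ^ 2 * (LkerLim n a (repO n x y) κ (repS n x y) l).re := by
  rw [Ga_apply, Kinf_of_ne n a h]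

/-- [folklore] The component block `(κ,l)` of `Ga` is an5's `KinfBlock` (an4's `Kernel₂` vocabulary), definitionally. -/
theorem Ga_eq_KinfBlock (κ l : Fin 4) : (fun x y => Ga n a x y κ l) = KinfBlock n a κ l := rfl

/-- [folklore] Every component block of `Ga` is jointly `n`-periodic (`Beta.IsPeriodic₂ n`). -/
theorem isPeriodic₂_Ga (hn : 1 ≤ n) (κ l : Fin 4) : IsPeriodic₂ n (fun x y => Ga n a x y κ l) := by
  rw [Ga_eq_KinfBlock]
  exact isPeriodic₂_KinfBlock n a hn κ l

/-! ## §2 Structure: symmetry, block-translation covariance, temperedness -/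

/-- [folklore] **`Ga` IS SYMMETRIC**: `Ga x y κ l = Ga y x l κ` (`n ≥ 1`, `a > 0`; `Kinf_symm` at `d = 4`). -/
theorem Ga_symm (hn : 1 ≤ n) (ha : 0 < a) (x y : Site 4) (κ l : Fin 4) : Ga n a x y κ l = Ga n a y x l κ := by
  rw [Ga_apply, Ga_apply]
  exact Kinf_symm n hn a ha (by norm_num) (x, κ) (y, l)

/-- [folklore] The same in transposition currency: `trK (Ga n a) = Ga n a` (`TameKernelCalculus.trK`). -/
theorem trK_Ga (hn : 1 ≤ n) (ha : 0 < a) : trK (Ga n a) = Ga n a := by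
  funext x y κ l
  exact (Ga_symm n a hn ha x y κ l).symm

omit [NeZero n] in
/-- [folklore] the coarse translation vector as a coordinate function. -/
theorem natCast_zsmul_eq (t : Site 4) : ((n : ℤ) • t : Site 4) = fun k => (n : ℤ) * t k := by
  funext k
  simp [Pi.smul_apply]

/-- [folklore] **BLOCK-TRANSLATION COVARIANCE**: shifting both legs by a coarse vector `n • t` leaves `Ga` unchanged (`Kinf_blockShift`). -/
theorem shiftK_Ga (hn : 1 ≤ n) (t : Site 4) : shiftK ((n : ℤ) • t) (Ga n a) = Ga n a := by
  funext x y κ l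
  simp only [shiftK, Ga_apply, natCast_zsmul_eq]
  exact Kinf_blockShift n a hn x y t κ l

/-- [folklore] The same with the sign convention of `ExpKernelCalculus.BlockCovariant.covA` (`shiftK (−(n • t))`). -/
theorem shiftK_Ga_neg (hn : 1 ≤ n) (t : Site 4) : shiftK (-((n : ℤ) • t)) (Ga n a) = Ga n a := by
  rw [← smul_neg]
  exact shiftK_Ga n a hn (-t)

/-- [folklore] `BlockCovariant` for `Ga` and ANY block-covariant vertex families at block `n` (the `covA` field is `shiftK_Ga_neg`;
`covV`/`covW` are the families' own covariance, cf. `OneStepResolventKernel.blockCovariant_KInv`). -/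
theorem blockCovariant_Ga (hn : 1 ≤ n) {V : Fin 4 → Site 4 → MKer 4 (Fin 4)} {W : Fin 4 → Site 4 → Fin 4 → Site 4 → MKer 4 (Fin 4)}
    (hV : ∀ (μ : Fin 4) (y t : Site 4), V μ (y + t) = shiftK (-((n : ℤ) • t)) (V μ y))
    (hW : ∀ (μ : Fin 4) (y : Site 4) (ν : Fin 4) (y' t : Site 4), W μ (y + t) ν (y' + t) = shiftK (-((n : ℤ) • t)) (W μ y ν y')) :
    BlockCovariant (Ga n a) V W n :=
  ⟨shiftK_Ga_neg n a hn, hV, hW⟩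

/-- [folklore] **THE BASE POINT `0` REPRESENTS EVERY BASE POINT** for the reduced kernels: for block-covariant vertex families over `Ga`,
`hess (Ga n a) V W μ y ν y′ = hessKer (Ga n a) V W μ ν (y′ − y)` (`ExpKernelCalculus.hess_eq_hessKer`). -/
theorem hess_Ga_eq_hessKer (hn : 1 ≤ n) {V : Fin 4 → Site 4 → MKer 4 (Fin 4)}
    {W : Fin 4 → Site 4 → Fin 4 → Site 4 → MKer 4 (Fin 4)}
    (hV : ∀ (μ : Fin 4) (y t : Site 4), V μ (y + t) = shiftK (-((n : ℤ) • t)) (V μ y))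
    (hW : ∀ (μ : Fin 4) (y : Site 4) (ν : Fin 4) (y' t : Site 4), W μ (y + t) ν (y' + t) = shiftK (-((n : ℤ) • t)) (W μ y ν y'))
    (μ : Fin 4) (y : Site 4) (ν : Fin 4) (y' : Site 4) :
    hess (Ga n a) V W μ y ν y' = hessKer (Ga n a) V W μ ν (y' - y) :=
  hess_eq_hessKer (blockCovariant_Ga n a hn hV hW) μ y ν y'

/-- [folklore] **`Ga` IS TEMPERED**: `|Ga x y κ l| ≤ n²/γ₀(4,a)` for all entries — the volume-uniform (1.89) entry bound passed to the
limit (`abs_Kinf_le`; CONTEXT: [Balaban1984PropagatorsI, Prop. 1.1 (1.89) p. 33], nothing printed asserted). -/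
theorem abs_Ga_le (hn : 1 ≤ n) (ha : 0 < a) (x y : Site 4) (κ l : Fin 4) :
    |Ga n a x y κ l| ≤ ((n : ℕ) : ℝ) ^ 2 * (gammaZero 4 a)⁻¹ :=
  abs_Kinf_le n hn a ha (by norm_num) (x, κ) (y, l)

/-- [folklore] The same as `KernelWard.Bdd (Ga n a) (n²/γ₀)` (the third field of `TameKernelCalculus.Tame`; the row/column majorants
`RowMaj`/`ColMaj` are NOT available for `Ga` — its rows are not summable). -/
theorem bdd_Ga (hn : 1 ≤ n) (ha : 0 < a) : Bdd (Ga n a) (((n : ℕ) : ℝ) ^ 2 * (gammaZero 4 a)⁻¹) :=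
  fun x y κ l => abs_Ga_le n a hn ha x y κ l

omit [NeZero n] in
/-- [folklore] The bound's constant is positive (`γ₀(4,a) > 0` for every `a`, `B5Prop11Lattice.gammaZero_pos`). -/
theorem bdd_const_pos (hn : 1 ≤ n) : 0 < ((n : ℕ) : ℝ) ^ 2 * (gammaZero 4 a)⁻¹ := by
  have h1 : (0 : ℝ) < ((n : ℕ) : ℝ) := by exact_mod_cast hn
  have h2 := gammaZero_pos 4 a
  positivity

/-! ## §3 The reading: the diagonal displacement function of `Ga` is the wall's `GfE`; `Ga` is the volume limit of `n²·Re Δ_a⁻¹` -/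

/-- [folklore] **`Ga`'S DIAGONAL DISPLACEMENT FUNCTION IS `GfE`**: at base point `p`, label `ℓ` with component `k ℓ`, displacement `v`,
`Ga n a (p + v) p (k ℓ) (k ℓ) = GfE a k n (p, ℓ) v` (`VectorPropagatorLimit.GfE_eq_Kinf`) — so the (R17) window/tail rows of
`VectorLegVolumeAdapter` and the table side `SquareTable.stK μ ν N (GfE a k n b)` are statements about `Ga`'s diagonal entries. -/
theorem Ga_eq_GfE {L : Type*} (k : L → Fin 4) (p : Pt) (ℓ : L) (v : Pt) :
    Ga n a (p + v) p (k ℓ) (k ℓ) = GfE a k n (p, ℓ) v := by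
  rw [Ga_apply, GfE_eq_Kinf a k n (p, ℓ) v]

/-- [folklore] Component-indexed form (`L := Fin 4`, `k := id`): `Ga n a (p + v) p κ κ = GfE a id n (p, κ) v`. -/
theorem Ga_eq_GfE_id (p : Pt) (κ : Fin 4) (v : Pt) : Ga n a (p + v) p κ κ = GfE a id n (p, κ) v :=
  Ga_eq_GfE n a id p κ v

/-- [folklore] As functions of the displacement: `(fun v => Ga n a (p + v) p κ κ) = GfE a id n (p, κ)`. -/
theorem Ga_displacement_eq_GfE (p : Pt) (κ : Fin 4) : (fun v => Ga n a (p + v) p κ κ) = GfE a id n (p, κ) :=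
  funext fun v => Ga_eq_GfE_id n a p κ v

/-- [folklore] an4's displacement function of the component block: `baseFun (fun x y => Ga n a x y κ l) p v = Ga n a (p + v) p κ l`. -/
theorem baseFun_Ga (κ l : Fin 4) (p v : Pt) : baseFun (fun x y => Ga n a x y κ l) p v = Ga n a (p + v) p κ l := rfl

/-- [folklore] **`Ga` IS THE `T ↗ ℤ⁴` LIMIT OF THE TORUS PROPAGATORS IN LATTICE UNITS**: along the even cubic volumes `(ℤ/(n·2(t+1)))⁴`,
`n²·Re Δ_a⁻¹((x̄,κ),(ȳ,l)) → Ga n a x y κ l` (`calG_re_tendsto_Kinf` at `d = 4`; node V's passage for the legs — CONTEXT: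
[Balaban1987RG1, p. 264 «Now we take a limit of these functions as T^{(j+1)} ↗ Z^d»], nothing printed asserted). -/
theorem tendsto_Ga (hn : 1 ≤ n) (ha : 0 < a) (x y : Site 4) (κ l : Fin 4) :
    Tendsto (fun t => ((n : ℕ) : ℝ) ^ 2 *
      (calG n hn (cubic 4 (evenPeriod t)) a ha (castT (fine n (cubic 4 (evenPeriod t))) x, κ)
        (castT (fine n (cubic 4 (evenPeriod t))) y, l)).re) atTop (𝓝 (Ga n a x y κ l)) :=
  calG_re_tendsto_Kinf n hn a ha (by norm_num) x y κ l

end Summit.QuantumFields.BalabanUV.Beta.D1BFx.GluonLeg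

end
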